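import Literature.MathematicalPhysics.QuantumLattice.YangMillsHeatFlowGradientEnergy
import HarnessLib

/-!
# `ε`-regularity for the Yang–Mills flow in dimension four: the gradient bound (`k = 1`)

QuantumLattice support file (everything proved; no definitions, no named facts) on the proof
path of `Literature.MathematicalPhysics.QuantumLattice.Waldron2019_yangMillsFlow_flatTorus`
(A. Waldron, Invent. math. 217 (2019)), §3, Prop. 3.1(a) for `k = 1` (after [instantons]
Lemma 3.1, the Bernstein–Hamilton–Weinkove derivative estimates), flat setting:

  `sup_{[τ−R², τ]} ∫_{B_R(x₀)} e ≤ ε < ε₀  ⟹  |∇_A F(t, x)|² = ∑_{ijk}‖DᵢF_{jk}‖² ≤ C ε R⁻⁶`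

for `t ∈ [τ − R²/2, τ]`, `x ∈ B̄_{R/2}(x₀)`, i.e. `‖∇F(t)‖_{L^∞(B_{R/2})} ≤ C₁ R⁻³ √ε`.

Proof: by part (a), `k = 0` (`sup_weighted_ymDensity_le`) `e ≤ M = 256Kε R⁻⁴` on
`[τ − 9R²/16, τ] × B̄_{3R/4}(x₀)`; there the Bochner inequality for `N = |∇F|²`
(`deriv_gradDensity_sub_laplacian_le`) is linear, `∂ₜN − ΔN ≤ 24√2 (card ι) √M · N`, so the
mean-value inequality for linear subsolutions
(`Literature.Analysis.PDE.le_mul_integral_of_linear_subsolution_basis`) on the cylinder of radius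
`ρ = R/8` at `(t, x)` bounds `N(t, x)` by `C ρ⁻⁶ ∫∫_{Q_ρ} N`, and the localized space-time
`L²` bound (`intervalIntegral_integral_sq_mul_gradDensity_le`, cut-off for `B_ρ(x) ⊂ B_{2ρ}(x)`)
gives `∫∫_{Q_ρ} N ≤ C' ε`.

* `Waldron2019_prop_3_1a_k1` — the statement above.

References: A. Waldron, Invent. math. 217 (2019), Prop. 3.1(a) [Waldron2019]; A. Waldron,
Calc. Var. PDE 55 (2016), Lemma 3.1 [Waldron2016]; B. Weinkove, Calc. Var. PDE 19 (2004), §2.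
-/

noncomputable section

open scoped ContDiff Topology RealInnerProductSpace Matrix NNReal ENNReal
open Set Filter MeasureTheory Metric

namespace Literature.MathematicalPhysics.QuantumLattice

section GradRegularity

open scoped Matrix.Norms.Frobenius

attribute [local instance] frobeniusInnerProductSpace

variable {m : Type*} [Fintype m] [DecidableEq m]
variable {E : Type*} [NormedAddCommGroup E] [InnerProductSpace ℝ E] [FiniteDimensional ℝ E]
  [MeasurableSpace E] [BorelSpace E]
variable {ι : Type*} [Fintype ι] [LinearOrder ι]

/-- Finite differentiability orders are below `∞`. [folklore] -/
private theorem natCast_le_infty₉ (n : ℕ) : (n : WithTop ℕ∞) ≤ (⊤ : ℕ∞) := by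
  exact_mod_cast le_top

omit [FiniteDimensional ℝ E] [MeasurableSpace E] [BorelSpace E] [LinearOrder ι] in
/-- The index type of an orthonormal basis of a `4`-dimensional space has `4` elements.
[folklore] -/
private theorem card_eq_four_of_finrank' (hE : Module.finrank ℝ E = 4) (b : OrthonormalBasis ι ℝ E) :
    (Fintype.card ι : ℝ) = 4 := by
  have h := Module.finrank_eq_card_basis b.toBasis
  rw [hE] at h
  exact_mod_cast h.symm

/-- **`ε`-regularity, gradient bound (Waldron 2019, Prop. 3.1(a), `k = 1`; flat setting, proved).**
There are `ε₀ = ε₀(E, ι) > 0` and `C = C(E, ι)` such that for every jointly smooth `𝔲(m)`-valued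
solution `A` of the Yang–Mills heat equation `∂ₜA = div_A F_A` on an open time set
`𝒯 ⊇ [τ − R², τ]` (`R > 0`) with `sup_{t ∈ [τ−R², τ]} ∫_{B_R(x₀)} e(t) ≤ ε < ε₀`, for all
`t ∈ [τ − R²/2, τ]` and `x ∈ B̄_{R/2}(x₀)`: `∑_{ijk} ‖DᵢF_{jk}(t, x)‖² ≤ C ε R⁻⁶` — the `k = 1`
case of `‖∇^{(k)}F(t)‖_{L^∞(B_{R/2})} ≤ C_k R^{-2-k} √ε`.
[cite: Waldron2019, Prop. 3.1(a) (k = 1); Waldron2016, Lemma 3.1] -/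
theorem Waldron2019_prop_3_1a_k1 (hE : Module.finrank ℝ E = 4) (b : OrthonormalBasis ι ℝ E) :
    ∃ ε₀ : ℝ, 0 < ε₀ ∧ ∃ C : ℝ, 0 < C ∧ ∀ {A : ℝ → Connection E (Matrix m m ℂ)} {𝒯 : Set ℝ},
      IsOpen 𝒯 → ContDiffOn ℝ ∞ (fun p : ℝ × E => A p.1 p.2) (𝒯 ×ˢ (univ : Set E)) →
      (∀ ⦃s : ℝ⦄, s ∈ 𝒯 → (A s).IsValuedIn (skewAdjoint.submodule ℝ (Matrix m m ℂ))) →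
      (∀ ⦃s : ℝ⦄, s ∈ 𝒯 → ∀ y w, deriv (fun s' => A s' y w) s = divCurvature (A s) y w) →
      ∀ (x₀ : E) {R : ℝ}, 0 < R → ∀ {τ : ℝ}, Icc (τ - R ^ 2) τ ⊆ 𝒯 →
      ∀ {ε : ℝ}, ε < ε₀ →
      (∀ t ∈ Icc (τ - R ^ 2) τ, ∫ y in ball x₀ R, ymDensityOfBasis b (A t) y ≤ ε) →
      ∀ t ∈ Icc (τ - R ^ 2 / 2) τ, ∀ x ∈ closedBall x₀ (R / 2),
        ∑ i, ∑ j, ∑ k, ‖covDeriv (A t) (fun z => curvature (A t) z (b j) (b k)) x (b i)‖ ^ 2 ≤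
          C * ε / R ^ 6 := by
  obtain ⟨ε₁, hε₁, K, hK, hSch⟩ := sup_weighted_ymDensity_le (m := m) hE b
  obtain ⟨Cl, hCl, hLin⟩ := Analysis.PDE.le_mul_integral_of_linear_subsolution_basis (E := E) b
  obtain ⟨M', hM'0, hrad⟩ := Literature.Analysis.Calculus.exists_radial_cutoff_gradient_le (E := E)
  set A₅ : ℝ := 24 * Real.sqrt 2 * (Fintype.card ι : ℝ) with hA₅
  set A₃ : ℝ := 8 * Real.sqrt 2 * (Fintype.card ι : ℝ) ^ 3 with hA₃
  have hA₅pos : 0 < A₅ := by rw [hA₅, card_eq_four_of_finrank' hE b]; positivity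
  have hA₃pos : 0 < A₃ := by rw [hA₃, card_eq_four_of_finrank' hE b]; positivity
  set ε₀ : ℝ := min ε₁ (min (16 / (A₅ ^ 2 * K)) (16 / (A₃ ^ 2 * K))) with hε₀
  refine ⟨ε₀, lt_min hε₁ (lt_min (by positivity) (by positivity)), Cl * (4 + 8 * M' ^ 2) * 8 ^ 6,
    by positivity, ?_⟩
  intro A 𝒯 h𝒯 hA hval hpde x₀ R hR τ hI ε hε hsmall t ht x hx
  have hR2 : 0 < R ^ 2 := by positivity
  have hR4 : 0 < R ^ 4 := by positivity
  have he0 : ∀ s y, 0 ≤ ymDensityOfBasis b (A s) y := fun s y => ymDensityOfBasis_nonneg b _ y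
  have he_joint := contDiffOn_ymDensityOfBasis_joint_infty b h𝒯 hA
  have he_cont : ContinuousOn (fun q : ℝ × E => ymDensityOfBasis b (A q.1) q.2)
      (𝒯 ×ˢ (univ : Set E)) := he_joint.continuousOn
  have hN_joint : ContDiffOn ℝ ∞ (fun p : ℝ × E => ∑ i, ∑ j, ∑ k,
      ‖covDeriv (A p.1) (fun z => curvature (A p.1) z (b j) (b k)) p.2 (b i)‖ ^ 2)
      (𝒯 ×ˢ (univ : Set E)) :=
    ContDiffOn.sum fun i _ => ContDiffOn.sum fun j _ => ContDiffOn.sum fun k _ =>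
      (contDiffOn_covDeriv_curvature_joint h𝒯 hA (b j) (b k) (b i)).norm_sq ℝ
  have hN_cont := hN_joint.continuousOn
  have hN0 : ∀ s y, 0 ≤ ∑ i, ∑ j, ∑ k,
      ‖covDeriv (A s) (fun z => curvature (A s) z (b j) (b k)) y (b i)‖ ^ 2 := fun s y =>
    Finset.sum_nonneg fun i _ => Finset.sum_nonneg fun j _ => Finset.sum_nonneg fun k _ => by
      positivity
  have hε0 : 0 ≤ ε :=
    (setIntegral_nonneg (μ := volume) (s := ball x₀ R) (f := fun y => ymDensityOfBasis b (A τ) y)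
      measurableSet_ball fun y _ => he0 τ y).trans (hsmall τ ⟨by linarith, le_rfl⟩)
  have hx' : dist x x₀ ≤ R / 2 := mem_closedBall.1 hx
  -- ### part (a), `k = 0`: `e ≤ M = 256 K ε R⁻⁴` on `[τ − 9R²/16, τ] × B̄_{3R/4}(x₀)`
  have hreg : ∀ s ∈ Icc (τ - (3 * R / 4) ^ 2) τ, ∀ y ∈ closedBall x₀ (3 * R / 4),
      ymDensityOfBasis b (A s) y ≤ 256 * K * ε / R ^ 4 := by
    intro s hs y hy
    have h := hSch h𝒯 hA hval hpde x₀ hR hI (lt_of_lt_of_le hε (min_le_left _ _)) hsmall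
      (by positivity : (0 : ℝ) ≤ 3 * R / 4) (by linarith : 3 * R / 4 ≤ R) s hs y hy
    rw [show (R - 3 * R / 4) ^ 4 = R ^ 4 / 256 by ring] at h
    rw [le_div_iff₀ hR4]
    linarith
  -- ### the cylinder `Q_ρ(t, x)`, `ρ = R/8`, and the parameters
  have hρpos : 0 < R / 8 := by positivity
  have hρ2 : 0 ≤ (R / 8) ^ 2 := sq_nonneg _
  have hIρτ : Icc (t - (R / 8) ^ 2) t ⊆ Icc (τ - R ^ 2) τ := fun s hs =>
    ⟨by nlinarith only [hs.1, ht.1, hR2], hs.2.trans ht.2⟩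
  have hIρ : Icc (t - (R / 8) ^ 2) t ⊆ 𝒯 := hIρτ.trans hI
  have hM0 : 0 ≤ 256 * K * ε / R ^ 4 := by positivity
  have hsqM : Real.sqrt (256 * K * ε / R ^ 4) = 16 * Real.sqrt (K * ε) / R ^ 2 := by
    rw [show 256 * K * ε / R ^ 4 = (16 * Real.sqrt (K * ε) / R ^ 2) ^ 2 by
      rw [div_pow, mul_pow, Real.sq_sqrt (by positivity)]; ring]
    exact Real.sqrt_sq (by positivity)
  -- `e ≤ M` on the slightly larger region `[t − ρ², t] × B̄_{3R/4}(x₀)`, containing everything below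
  have hregion : ∀ s ∈ Icc (t - (R / 8) ^ 2) t, ∀ y, dist y x < R / 4 →
      ymDensityOfBasis b (A s) y ≤ 256 * K * ε / R ^ 4 := by
    intro s hs y hy
    refine hreg s ⟨by nlinarith only [hs.1, ht.1, hR2], hs.2.trans ht.2⟩ y (mem_closedBall.2 ?_)
    linarith only [dist_triangle y x x₀, hy, hx']
  -- smallness of `A₅ √M ρ²` and `A₃ √M ρ²`
  have hsmallKε : ∀ {Aq : ℝ}, 0 < Aq → ε ≤ 16 / (Aq ^ 2 * K) →
      Aq * Real.sqrt (256 * K * ε / R ^ 4) * (R / 8) ^ 2 ≤ 1 := by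
    intro Aq hAq hεq
    have hKε : Real.sqrt (K * ε) ≤ 4 / Aq := by
      rw [← Real.sqrt_sq (by positivity : (0 : ℝ) ≤ 4 / Aq)]
      refine Real.sqrt_le_sqrt ?_
      rw [div_pow]
      calc K * ε ≤ K * (16 / (Aq ^ 2 * K)) := by gcongr
        _ = 4 ^ 2 / Aq ^ 2 := by field_simp; norm_num
    calc Aq * Real.sqrt (256 * K * ε / R ^ 4) * (R / 8) ^ 2 = Aq * Real.sqrt (K * ε) / 4 := by
          rw [hsqM]; field_simp; ring
      _ ≤ Aq * (4 / Aq) / 4 := by gcongr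
      _ = 1 := by field_simp
  have hε5 : ε ≤ 16 / (A₅ ^ 2 * K) := (le_of_lt hε).trans ((min_le_right _ _).trans (min_le_left _ _))
  have hε3 : ε ≤ 16 / (A₃ ^ 2 * K) := (le_of_lt hε).trans ((min_le_right _ _).trans (min_le_right _ _))
  have hΛρ : A₅ * Real.sqrt (256 * K * ε / R ^ 4) * (R / 8) ^ 2 ≤ 1 := hsmallKε hA₅pos hε5
  have hA₃ρ : A₃ * Real.sqrt (256 * K * ε / R ^ 4) * (R / 8) ^ 2 ≤ 1 := hsmallKε hA₃pos hε3
  -- ### the linear subsolution property of `N` on `Q_ρ(t, x)`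
  have hsub : ∀ s ∈ Icc (t - (R / 8) ^ 2) t, ∀ y ∈ closedBall x (R / 8),
      deriv (fun s' => (∑ i, ∑ j, ∑ k, ‖covDeriv (A s') (fun z => curvature (A s') z (b j) (b k)) y (b i)‖ ^ 2)) s -
        ∑ l, fderiv ℝ (fun z => fderiv ℝ (fun y' => (∑ i, ∑ j, ∑ k, ‖covDeriv (A s) (fun z => curvature (A s) z (b j) (b k)) y' (b i)‖ ^ 2)) z (b l)) y (b l) ≤
        A₅ * Real.sqrt (256 * K * ε / R ^ 4) * (∑ i, ∑ j, ∑ k, ‖covDeriv (A s) (fun z => curvature (A s) z (b j) (b k)) y (b i)‖ ^ 2) := by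
    intro s hs y hy
    have hs𝒯 : s ∈ 𝒯 := hIρ hs
    have hB := deriv_gradDensity_sub_laplacian_le b h𝒯 hA hval hpde hs𝒯 y
    have hyx : dist y x < R / 4 := by linarith only [mem_closedBall.1 hy, hR]
    have hsq : Real.sqrt (ymDensityOfBasis b (A s) y) ≤ Real.sqrt (256 * K * ε / R ^ 4) :=
      Real.sqrt_le_sqrt (hregion s hs y hyx)
    have hNy := hN0 s y
    have hneg : 0 ≤ 2 * ∑ l, ∑ i, ∑ j, ∑ k, ‖covDeriv (A s) (fun y' => covDeriv (A s)
        (fun z => curvature (A s) z (b j) (b k)) y' (b i)) y (b l)‖ ^ 2 :=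
      mul_nonneg zero_le_two (Finset.sum_nonneg fun _ _ => Finset.sum_nonneg fun _ _ =>
        Finset.sum_nonneg fun _ _ => Finset.sum_nonneg fun _ _ => sq_nonneg _)
    have h2 : 24 * Real.sqrt 2 * (Fintype.card ι : ℝ) * Real.sqrt (ymDensityOfBasis b (A s) y) *
        (∑ i, ∑ j, ∑ k, ‖covDeriv (A s) (fun z => curvature (A s) z (b j) (b k)) y (b i)‖ ^ 2) ≤ A₅ * Real.sqrt (256 * K * ε / R ^ 4) * (∑ i, ∑ j, ∑ k, ‖covDeriv (A s) (fun z => curvature (A s) z (b j) (b k)) y (b i)‖ ^ 2) := by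
      rw [hA₅]
      exact mul_le_mul_of_nonneg_right (mul_le_mul_of_nonneg_left hsq (by positivity)) hNy
    have h3 : -(2 * ∑ l, ∑ i, ∑ j, ∑ k, ‖covDeriv (A s) (fun y' => covDeriv (A s)
        (fun z => curvature (A s) z (b j) (b k)) y' (b i)) y (b l)‖ ^ 2) +
        24 * Real.sqrt 2 * (Fintype.card ι : ℝ) * Real.sqrt (ymDensityOfBasis b (A s) y) *
        (∑ i, ∑ j, ∑ k, ‖covDeriv (A s) (fun z => curvature (A s) z (b j) (b k)) y (b i)‖ ^ 2) ≤
        24 * Real.sqrt 2 * (Fintype.card ι : ℝ) * Real.sqrt (ymDensityOfBasis b (A s) y) *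
        (∑ i, ∑ j, ∑ k, ‖covDeriv (A s) (fun z => curvature (A s) z (b j) (b k)) y (b i)‖ ^ 2) := by linarith only [hneg]
    exact hB.trans (h3.trans h2)
  -- ### the mean-value inequality for `N`
  have hmv := hLin (q := fun s y => (∑ i, ∑ j, ∑ k, ‖covDeriv (A s) (fun z => curvature (A s) z (b j) (b k)) y (b i)‖ ^ 2)) h𝒯 hN_joint hρpos hIρ (by positivity)
    hΛρ (fun s _ y _ => hN0 s y) hsub
  rw [hE] at hmv
  -- ### the cut-off for the pair of balls of radii `ρ`, `2ρ` and the localized `L²` bound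
  obtain ⟨φ, hφs, hφ0, hφ1, hone, hzero, hφcs, hgrad⟩ := hrad x (R / 8) (R / 4) hρpos (by linarith)
  have hφC1 : ContDiff ℝ 1 φ := hφs.of_le (natCast_le_infty₉ 1)
  have hKφ : ∀ y, ‖fderiv ℝ φ y‖ ≤ 8 * M' / R := fun y => by
    have h := hgrad y
    rwa [show R / 4 - R / 8 = R / 8 by ring, div_div_eq_mul_div, show M' * 8 = 8 * M' by ring] at h
  have htsupp : tsupport φ ⊆ closedBall x (R / 4) := by
    refine closure_minimal (fun y hy => ?_) isClosed_closedBall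
    rw [mem_closedBall]
    by_contra h
    exact hy (hzero y (le_of_lt (not_le.1 h)))
  have hφU : ∀ y ∉ closedBall x (R / 4), fderiv ℝ φ y = 0 := fun y hy =>
    fderiv_eq_zero_of_notMem_tsupport fun h => hy (htsupp h)
  have hφne : ∀ y, φ y ≠ 0 → dist y x < R / 4 := fun y hy =>
    lt_of_not_ge fun h => hy (hzero y h)
  have hS : ∀ s ∈ Icc (t - (R / 8) ^ 2) t, ∀ y, φ y ≠ 0 →
      Real.sqrt (ymDensityOfBasis b (A s) y) ≤ Real.sqrt (256 * K * ε / R ^ 4) := fun s hs y hy =>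
    Real.sqrt_le_sqrt (hregion s hs y (hφne y hy))
  have hle : t - (R / 8) ^ 2 ≤ t := by linarith only [hρ2]
  have hL2 := intervalIntegral_integral_sq_mul_gradDensity_le b h𝒯 hA hval hpde hφC1 hφcs
    (isCompact_closedBall x (R / 4)) Subset.rfl measurableSet_closedBall hφU hKφ hle hIρ hS
  -- ### bounds for the three terms on the right
  have hUball : closedBall x (R / 4) ⊆ ball x₀ R := fun y hy =>
    mem_ball.2 (by linarith only [mem_closedBall.1 hy, dist_triangle y x x₀, hx', hR])
  have heI : ∀ ⦃s : ℝ⦄, s ∈ 𝒯 → ∀ (c : E) (r : ℝ),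
      IntegrableOn (fun y => ymDensityOfBasis b (A s) y) (closedBall c r) := fun s hs c r =>
    (continuous_slice_of_continuousOn_slab he_cont hs).continuousOn.integrableOn_compact
      (isCompact_closedBall c r)
  have hUe : ∀ s ∈ Icc (t - (R / 8) ^ 2) t, (∫ y in closedBall x (R / 4), ymDensityOfBasis b (A s) y) ≤ ε := by
    intro s hs
    refine (setIntegral_mono_set ((heI (hI (hIρτ hs)) x₀ R).mono_set ball_subset_closedBall)
      (ae_of_all _ fun y => he0 s y) hUball.eventuallyLE).trans (hsmall s (hIρτ hs))
  have hφ2e : ∀ s ∈ Icc (t - (R / 8) ^ 2) t,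
      (∫ y, φ y ^ 2 * ymDensityOfBasis b (A s) y) ≤ ∫ y in closedBall x (R / 4), ymDensityOfBasis b (A s) y := by
    intro s hs
    have hs𝒯 : s ∈ 𝒯 := hIρ hs
    have hes : Continuous fun y => ymDensityOfBasis b (A s) y := continuous_slice_of_continuousOn_slab he_cont hs𝒯
    have hz : ∀ y ∉ closedBall x (R / 4), φ y ^ 2 * ymDensityOfBasis b (A s) y = 0 := fun y hy => by
      have : φ y = 0 := hzero y (le_of_lt (not_le.1 (mt mem_closedBall.2 hy)))
      rw [this]; ring
    rw [← setIntegral_eq_integral_of_forall_compl_eq_zero hz]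
    refine setIntegral_mono_on (((hφs.continuous.pow 2).mul hes).continuousOn.integrableOn_compact
      (isCompact_closedBall x (R / 4))) (heI hs𝒯 x (R / 4)) measurableSet_closedBall fun y _ => ?_
    have h1 : φ y ^ 2 ≤ 1 := by nlinarith only [hφ1 y, hφ0 y]
    calc φ y ^ 2 * ymDensityOfBasis b (A s) y ≤ 1 * ymDensityOfBasis b (A s) y :=
          mul_le_mul_of_nonneg_right h1 (he0 s y)
      _ = _ := one_mul _
  -- continuity in time of the space integrals (for interval integrability)
  have hEUc : ContinuousOn (fun s => ∫ y in closedBall x (R / 4), ymDensityOfBasis b (A s) y) 𝒯 :=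
    continuousOn_setIntegral_of_continuousOn_slab h𝒯 (g := fun p : ℝ × E => ymDensityOfBasis b (A p.1) p.2)
      he_cont (isCompact_closedBall x (R / 4)) Subset.rfl measurableSet_closedBall
  have hφ2s : HasCompactSupport fun y => φ y ^ 2 := hasCompactSupport_sq hφcs
  have hφ2c : Continuous fun y => φ y ^ 2 := hφs.continuous.pow 2
  have hYc : ContinuousOn (fun s => ∫ y, φ y ^ 2 * ymDensityOfBasis b (A s) y) 𝒯 :=
    continuousOn_integral_mul_of_continuousOn_slab h𝒯 (g := fun p : ℝ × E => ymDensityOfBasis b (A p.1) p.2)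
      he_cont hφ2c hφ2s
  have hGc : ContinuousOn (fun s => ∫ y, φ y ^ 2 * (∑ i, ∑ j, ∑ k, ‖covDeriv (A s) (fun z => curvature (A s) z (b j) (b k)) y (b i)‖ ^ 2)) 𝒯 :=
    continuousOn_integral_mul_of_continuousOn_slab h𝒯 (g := fun p : ℝ × E => (∑ i, ∑ j, ∑ k, ‖covDeriv (A p.1) (fun z => curvature (A p.1) z (b j) (b k)) p.2 (b i)‖ ^ 2))
      hN_cont hφ2c hφ2s
  have hBc : ContinuousOn (fun s => ∫ y in closedBall x (R / 8), (∑ i, ∑ j, ∑ k, ‖covDeriv (A s) (fun z => curvature (A s) z (b j) (b k)) y (b i)‖ ^ 2)) 𝒯 :=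
    continuousOn_setIntegral_of_continuousOn_slab h𝒯 (g := fun p : ℝ × E => (∑ i, ∑ j, ∑ k, ‖covDeriv (A p.1) (fun z => curvature (A p.1) z (b j) (b k)) p.2 (b i)‖ ^ 2))
      hN_cont (isCompact_closedBall x (R / 8)) Subset.rfl measurableSet_closedBall
  have hIi : ∀ ⦃f : ℝ → ℝ⦄, ContinuousOn f 𝒯 → IntervalIntegrable f volume (t - (R / 8) ^ 2) t :=
    fun f hf => ContinuousOn.intervalIntegrable (by rw [uIcc_of_le hle]; exact hf.mono hIρ)
  -- (T2) `∫∫_U e ≤ ρ² ε`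
  have hT2 : (∫ s in (t - (R / 8) ^ 2)..t, ∫ y in closedBall x (R / 4), ymDensityOfBasis b (A s) y) ≤
      (R / 8) ^ 2 * ε := by
    calc (∫ s in (t - (R / 8) ^ 2)..t, ∫ y in closedBall x (R / 4), ymDensityOfBasis b (A s) y)
        ≤ ∫ _s in (t - (R / 8) ^ 2)..t, ε :=
          intervalIntegral.integral_mono_on hle (hIi hEUc) intervalIntegrable_const fun s hs => hUe s hs
      _ = (R / 8) ^ 2 * ε := by rw [intervalIntegral.integral_const, smul_eq_mul]; ring
  -- (T3) `∫∫ φ² e ≤ ρ² ε`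
  have hT3 : (∫ s in (t - (R / 8) ^ 2)..t, ∫ y, φ y ^ 2 * ymDensityOfBasis b (A s) y) ≤ (R / 8) ^ 2 * ε :=
    (intervalIntegral.integral_mono_on hle (hIi hYc) (hIi hEUc) fun s hs => hφ2e s hs).trans hT2
  -- (T1) `∫ φ² e(t − ρ²) ≤ ε`
  have hT1 : (∫ y, φ y ^ 2 * ymDensityOfBasis b (A (t - (R / 8) ^ 2)) y) ≤ ε :=
    (hφ2e _ (left_mem_Icc.2 hle)).trans (hUe _ (left_mem_Icc.2 hle))
  -- the right-hand side of the `L²` bound is `≤ (4 + 8 M'²) ε`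
  have hRHS : 2 * (∫ y, φ y ^ 2 * ymDensityOfBasis b (A (t - (R / 8) ^ 2)) y) +
      8 * (8 * M' / R) ^ 2 * (∫ s in (t - (R / 8) ^ 2)..t, ∫ y in closedBall x (R / 4),
        ymDensityOfBasis b (A s) y) +
      2 * (8 * Real.sqrt 2 * (Fintype.card ι : ℝ) ^ 3) * Real.sqrt (256 * K * ε / R ^ 4) *
        (∫ s in (t - (R / 8) ^ 2)..t, ∫ y, φ y ^ 2 * ymDensityOfBasis b (A s) y) ≤ (4 + 8 * M' ^ 2) * ε := by
    have h2 : 8 * (8 * M' / R) ^ 2 * (∫ s in (t - (R / 8) ^ 2)..t, ∫ y in closedBall x (R / 4),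
        ymDensityOfBasis b (A s) y) ≤ 8 * M' ^ 2 * ε := by
      calc 8 * (8 * M' / R) ^ 2 * (∫ s in (t - (R / 8) ^ 2)..t, ∫ y in closedBall x (R / 4),
            ymDensityOfBasis b (A s) y) ≤ 8 * (8 * M' / R) ^ 2 * ((R / 8) ^ 2 * ε) :=
            mul_le_mul_of_nonneg_left hT2 (by positivity)
        _ = 8 * M' ^ 2 * ε := by field_simp
    have h3 : 2 * (8 * Real.sqrt 2 * (Fintype.card ι : ℝ) ^ 3) * Real.sqrt (256 * K * ε / R ^ 4) *
        (∫ s in (t - (R / 8) ^ 2)..t, ∫ y, φ y ^ 2 * ymDensityOfBasis b (A s) y) ≤ 2 * ε := by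
      rw [← hA₃]
      calc 2 * A₃ * Real.sqrt (256 * K * ε / R ^ 4) * (∫ s in (t - (R / 8) ^ 2)..t, ∫ y, φ y ^ 2 * ymDensityOfBasis b (A s) y)
          ≤ 2 * A₃ * Real.sqrt (256 * K * ε / R ^ 4) * ((R / 8) ^ 2 * ε) :=
            mul_le_mul_of_nonneg_left hT3 (by positivity)
        _ = 2 * (A₃ * Real.sqrt (256 * K * ε / R ^ 4) * (R / 8) ^ 2) * ε := by ring
        _ ≤ 2 * 1 * ε := by
            exact mul_le_mul_of_nonneg_right (mul_le_mul_of_nonneg_left hA₃ρ (by norm_num)) hε0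
        _ = 2 * ε := by ring
    linarith only [hT1, h2, h3]
  -- ### the left-hand side: `∫∫_{Q_ρ} N ≤ ∫∫ φ² N`
  have hLHS : (∫ s in (t - (R / 8) ^ 2)..t, ∫ y in closedBall x (R / 8), (∑ i, ∑ j, ∑ k, ‖covDeriv (A s) (fun z => curvature (A s) z (b j) (b k)) y (b i)‖ ^ 2)) ≤
      ∫ s in (t - (R / 8) ^ 2)..t, ∫ y, φ y ^ 2 * (∑ i, ∑ j, ∑ k, ‖covDeriv (A s) (fun z => curvature (A s) z (b j) (b k)) y (b i)‖ ^ 2) := by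
    refine intervalIntegral.integral_mono_on hle (hIi hBc) (hIi hGc) fun s hs => ?_
    have hs𝒯 : s ∈ 𝒯 := hIρ hs
    have hNs : Continuous fun y => (∑ i, ∑ j, ∑ k, ‖covDeriv (A s) (fun z => curvature (A s) z (b j) (b k)) y (b i)‖ ^ 2) := continuous_slice_of_continuousOn_slab hN_cont hs𝒯
    have hfi : Integrable fun y => φ y ^ 2 * (∑ i, ∑ j, ∑ k, ‖covDeriv (A s) (fun z => curvature (A s) z (b j) (b k)) y (b i)‖ ^ 2) :=
      (hφ2c.mul hNs).integrable_of_hasCompactSupport hφ2s.mul_right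
    calc (∫ y in closedBall x (R / 8), (∑ i, ∑ j, ∑ k, ‖covDeriv (A s) (fun z => curvature (A s) z (b j) (b k)) y (b i)‖ ^ 2))
        = ∫ y in closedBall x (R / 8), φ y ^ 2 * (∑ i, ∑ j, ∑ k, ‖covDeriv (A s) (fun z => curvature (A s) z (b j) (b k)) y (b i)‖ ^ 2) :=
          setIntegral_congr_fun measurableSet_closedBall fun y hy => by
            rw [hone y (mem_closedBall.1 hy), one_pow, one_mul]
      _ ≤ ∫ y, φ y ^ 2 * (∑ i, ∑ j, ∑ k, ‖covDeriv (A s) (fun z => curvature (A s) z (b j) (b k)) y (b i)‖ ^ 2) :=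
          setIntegral_le_integral hfi (ae_of_all _ fun y => mul_nonneg (sq_nonneg _) (hN0 s y))
  -- ### assemble
  have hρ6 : 0 < (R / 8) ^ (4 + 2) := by positivity
  have hchain : (∫ s in (t - (R / 8) ^ 2)..t, ∫ y in closedBall x (R / 8), (∑ i, ∑ j, ∑ k, ‖covDeriv (A s) (fun z => curvature (A s) z (b j) (b k)) y (b i)‖ ^ 2)) ≤
      (4 + 8 * M' ^ 2) * ε := hLHS.trans (hL2.trans hRHS)
  calc (∑ i, ∑ j, ∑ k, ‖covDeriv (A t) (fun z => curvature (A t) z (b j) (b k)) x (b i)‖ ^ 2)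
      ≤ Cl / (R / 8) ^ (4 + 2) *
          ∫ s in (t - (R / 8) ^ 2)..t, ∫ y in closedBall x (R / 8), (∑ i, ∑ j, ∑ k, ‖covDeriv (A s) (fun z => curvature (A s) z (b j) (b k)) y (b i)‖ ^ 2) := hmv
    _ ≤ Cl / (R / 8) ^ (4 + 2) * ((4 + 8 * M' ^ 2) * ε) :=
        mul_le_mul_of_nonneg_left hchain (div_nonneg hCl.le hρ6.le)
    _ = Cl * (4 + 8 * M' ^ 2) * 8 ^ 6 * ε / R ^ 6 := by
        rw [show (4 : ℕ) + 2 = 6 from rfl, div_pow]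
        field_simp

end GradRegularity

end Literature.MathematicalPhysics.QuantumLattice
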